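import Literature.Analysis.FluidPDE.KatoL3FixedPointClass
import Literature.Analysis.FluidPDE.KochTataruIntegralOfClass
import Literature.Analysis.FluidPDE.BoundedRepresentative
import Literature.Analysis.FluidPDE.HeatExtensionDistribution
import Literature.Analysis.UnboundedOperators.HeatKernelGaussianData
import Literature.Analysis.UnboundedOperators.HeatSemigroupStrongContinuityProofs
import Literature.Analysis.UnboundedOperators.HeatSemigroupLpProofs
import Literature.Analysis.UnboundedOperators.HeatKernelFourier
import Mathlib.Analysis.Fourier.Convolution
import Mathlib.MeasureTheory.Integral.MeanInequalities
import HarnessLib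

/-!
# Kato-class fixed points with tempered data are mild solutions in the duality form

Analysis/FluidPDE proof file (no definitions, no named facts). It proves item (F4) of the
decomposition of `exists_isBesovMildSolutionOn` (BCD Thm. 5.40; Lemarié-Rieusset 2016, Thm. 6.1,
(6.12) ⇒ (6.11): a solution of Oseen's integral equation is a very weak solution): a field `u`
in Kato's weighted class `‖u(t)‖_{L^p} ≤ a t^{-(1-3/p)/2}`, `|u(t)(x)| ≤ b t^{-1/2}` (`3 < p < ∞`),
measurable on `(0,∞) × ℝ³`, with `u(t) = e^{tΔ}u₀ - B(u,u)(t)` a.e. on `(0, T)`, from a weakly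
divergence-free datum `u₀` known through its tempered distribution (`IsDistributionOf u₀ U₀`), is
an unforced mild solution on `[0, T)` in the duality form of `MildSolution.lean`
(`isMildNSSolutionOn_of_kato_fixedPoint'`). The tree's
`KatoL3.isMildNSSolutionOn_of_fixedPoint` is the case of an `L³` datum; what is new here:

* `KatoLp.eKochTataruNorm_lt_top_of_kato_bounds` — **Kato's `L^p`-weighted class lies in
  Koch–Tataru's path space `X`** (`‖u‖_X < ∞`: the Carleson part by Hölder on balls with
  exponent `p/2`, `∫_{B_R}|u(t)|² ≤ |B_R|^{1-2/p}‖u(t)‖_p² ≤ C R^{3-6/p} t^{-(1-3/p)}`, and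
  `∫₀^{R²} t^{-(1-3/p)} dt = (p/3) R^{6/p}`), so that the tested Duhamel identity and the weak
  solenoidality of `B(u,u)` of `KochTataruPairing.lean` apply;
* `integral_inner_heatExtension_comm_of_integrable_heatKernel` — **symmetry of the caloric
  pairing** `∫⟪e^{tΔ}u₀, φ⟫ = ∫⟪u₀, e^{tΔ}φ⟫` for data integrable against Gaussians and continuous
  compactly supported `φ` (Fubini under the off-centre Gaussian majorant);
* `schwartz_heatSemigroup_toSchwartzMap_apply` — the Schwartz-space heat semigroup of a real test
  function *is* its caloric extension (Fourier inversion; scalar twin of `caloricSchwartz_apply`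
  of `FujitaKatoTestFields.lean`), whence the integrability of `e^{tΔ}θ • u₀` and
  `D(e^{tΔ}θ)(u₀)` for `IsDistributionOf` data and
  `isWeaklyDivFree_heatExtension_of_isDistributionOf` — **the free evolution of a weakly
  divergence-free tempered datum is weakly divergence free** (Lemarié-Rieusset 2016, Cor. 6.2).

## References

* P. G. Lemarié-Rieusset, *The Navier–Stokes Problem in the 21st Century* (2016), Thm. 6.1
  (PDF p. 135), Cor. 6.2. [LemarieRieusset2016]
* H. Koch, D. Tataru, Adv. Math. 157 (2001), §1 (the path space `X`), §3 (11). [KochTataruAdvMath2001]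
* T. Kato, Math. Z. 187 (1984), Thm. 1. [Kato1984]
-/

noncomputable section

open MeasureTheory Set Function Filter Metric FourierTransform
open _root_.Topology
open scoped SchwartzMap ENNReal NNReal RealInnerProductSpace Convolution

namespace Literature.Analysis.FluidPDE

variable {E : Type*} [NormedAddCommGroup E] [InnerProductSpace ℝ E] [FiniteDimensional ℝ E]
  [MeasurableSpace E] [BorelSpace E]

/-! ## Kato's `L^p`-weighted class lies in Koch–Tataru's path space -/

namespace KatoLp

/-- **Hölder on balls with exponent `p/2`**: `∫_{B(x,R)} ‖f‖² ≤ (vol B(x,R))^{1-2/p} ‖f‖_{L^p}²`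
for `2 < p < ∞`. [folklore] -/
theorem lintegral_ball_enorm_sq_le_rpow {F : Type*} [NormedAddCommGroup F] {f : E → F}
    (hf : AEStronglyMeasurable f volume) {p : ℝ≥0∞} (hp2 : 2 < p) (hp : p < ∞) (x : E) (R : ℝ) :
    ∫⁻ y in ball x R, ‖f y‖ₑ ^ 2 ≤
      (volume (ball x R)) ^ (1 - 2 / p.toReal) * eLpNorm f p volume ^ 2 := by
  have hptop : p ≠ ∞ := hp.ne
  have hp0 : p ≠ 0 := (lt_trans (by norm_num) hp2).ne'
  have hp2r : (2 : ℝ) < p.toReal := by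
    have h := (ENNReal.toReal_lt_toReal ENNReal.ofNat_ne_top hptop).2 hp2
    simpa using h
  have hppos : 0 < p.toReal := by linarith
  set r : ℝ := p.toReal / 2 with hr
  have hr1 : 1 < r := by rw [hr]; linarith
  have hrpos : 0 < r := by linarith
  have hrr' : r.HolderConjugate (Real.conjExponent r) := Real.HolderConjugate.conjExponent hr1
  set r' : ℝ := Real.conjExponent r with hr'
  have hr'pos : 0 < r' := hrr'.symm.pos
  have hinv : 1 / r' = 1 - 2 / p.toReal := by
    rw [hr', Real.conjExponent, one_div, inv_div, sub_div, div_self hrpos.ne', hr, one_div_div]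
  -- Hölder for `1_B · ‖f‖²`
  set g : E → ℝ≥0∞ := (ball x R).indicator (fun _ => (1 : ℝ≥0∞)) with hg
  have hgm : AEMeasurable g volume := (measurable_one.indicator measurableSet_ball).aemeasurable
  have hfm : AEMeasurable (fun y => ‖f y‖ₑ ^ 2) volume := hf.enorm.pow_const _
  have h := ENNReal.lintegral_mul_le_Lp_mul_Lq (volume : Measure E) hrr'.symm hgm hfm
  have hleft : ∫⁻ y in ball x R, ‖f y‖ₑ ^ 2 = ∫⁻ y, (g * fun y => ‖f y‖ₑ ^ 2) y := by
    rw [← lintegral_indicator measurableSet_ball]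
    refine lintegral_congr fun y => ?_
    simp only [hg, Pi.mul_apply]
    by_cases hy : y ∈ ball x R <;> simp [hy]
  have hg_int : (∫⁻ y, g y ^ r') ^ (1 / r') = (volume (ball x R)) ^ (1 - 2 / p.toReal) := by
    have h1 : ∀ y, g y ^ r' = g y := fun y => by
      simp only [hg]
      by_cases hy : y ∈ ball x R <;> simp [hy, ENNReal.zero_rpow_of_pos hr'pos]
    simp_rw [h1]
    rw [hg, lintegral_indicator measurableSet_ball, setLIntegral_const, one_mul, hinv]
  have hf_int : (∫⁻ y, (‖f y‖ₑ ^ 2) ^ r) ^ (1 / r) = eLpNorm f p volume ^ 2 := by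
    have h1 : ∀ y, (‖f y‖ₑ ^ 2) ^ r = ‖f y‖ₑ ^ p.toReal := fun y => by
      rw [← ENNReal.rpow_natCast, ← ENNReal.rpow_mul]
      congr 1
      rw [hr]; push_cast; ring
    simp_rw [h1]
    rw [eLpNorm_eq_lintegral_rpow_enorm_toReal hp0 hptop, ← ENNReal.rpow_natCast,
      ← ENNReal.rpow_mul]
    congr 1
    rw [hr]; push_cast; field_simp
  rw [hleft]
  calc ∫⁻ y, (g * fun y => ‖f y‖ₑ ^ 2) y
      ≤ (∫⁻ y, g y ^ r') ^ (1 / r') * (∫⁻ y, (‖f y‖ₑ ^ 2) ^ r) ^ (1 / r) := h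
    _ = _ := by rw [hg_int, hf_int]

/-- The time integral of the squared `L^p` weight: `∫₀^{c} t^{-σ} dt = c^{1-σ}/(1-σ)` for
`0 < σ < 1`, in `ℝ≥0∞` form. [folklore] -/
theorem lintegral_Ioo_rpow_neg {σ c : ℝ} (hσ : σ < 1) (hc : 0 < c) :
    ∫⁻ t in Ioo 0 c, ENNReal.ofReal (t ^ (-σ)) = ENNReal.ofReal (c ^ (1 - σ) / (1 - σ)) := by
  have hσ' : -1 < -σ := by linarith
  have hint : IntegrableOn (fun t : ℝ => t ^ (-σ)) (Ioo 0 c) volume := by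
    have h := (intervalIntegral.intervalIntegrable_rpow' hσ' (a := 0) (b := c)).1
    exact h.mono_set Ioo_subset_Ioc_self
  have hnn : 0 ≤ᵐ[volume.restrict (Ioo 0 c)] fun t : ℝ => t ^ (-σ) :=
    (ae_restrict_mem measurableSet_Ioo).mono fun t ht => Real.rpow_nonneg ht.1.le _
  rw [← ofReal_integral_eq_lintegral_ofReal hint hnn]
  congr 1
  rw [← integral_Ioc_eq_integral_Ioo, ← intervalIntegral.integral_of_le hc.le,
    integral_rpow (Or.inl hσ'), Real.zero_rpow (by linarith), sub_zero]
  congr 1 <;> ring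

/-- **Kato's `L^p`-weighted class lies in Koch–Tataru's path space `X`** (dimension three;
Koch–Tataru 2001, §1: `X` is scale invariant, as is Kato's class): if `|u(t)(x)| ≤ b t^{-1/2}`
and `‖u(t)‖_{L^p} ≤ a t^{-(1-3/p)/2}` for all `t > 0` (`3 < p < ∞`, measurable slices), then
`‖u‖_X < ∞`: the `L^∞` part is `≤ b`, and for the Carleson part
`R⁻³ ∫₀^{R²}∫_{B(x,R)}|u|² ≤ R⁻³ (V₁R³)^{1-2/p} a² (R²)^{3/p}/(3/p) = V₁^{1-2/p} a² p/3`.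
[cite: KochTataruAdvMath2001, §1 (the path space X)] -/
theorem eKochTataruNorm_lt_top_of_kato_bounds (hE : Module.finrank ℝ E = 3) {u : ℝ → E → E}
    (hmeas : ∀ t, 0 < t → AEStronglyMeasurable (u t) volume) {p : ℝ≥0∞} (hp₃ : 3 < p) (hp : p < ∞)
    {a b : ℝ} (hinf : ∀ t, 0 < t → ∀ x, ‖u t x‖ ≤ b * t ^ (-(1 / 2 : ℝ)))
    (hLp : ∀ t, 0 < t → eLpNorm (u t) p volume ≤
      ENNReal.ofReal (a * t ^ (-((1 - 3 / p.toReal) / 2)))) :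
    eKochTataruNorm u < ∞ := by
  have hptop : p ≠ ∞ := hp.ne
  have hp3r : (3 : ℝ) < p.toReal := by
    have h := (ENNReal.toReal_lt_toReal ENNReal.ofNat_ne_top hptop).2 hp₃
    simpa using h
  have hppos : 0 < p.toReal := by linarith
  have hp2 : 2 < p := lt_trans (by norm_num) hp₃
  set σ : ℝ := 1 - 3 / p.toReal with hσ
  set θ : ℝ := 1 - 2 / p.toReal with hθ
  have hσ1 : σ < 1 := by
    have : 0 < 3 / p.toReal := by positivity
    rw [hσ]; linarith
  have hσ0 : 0 < σ := by
    have : 3 / p.toReal < 1 := (div_lt_one hppos).2 hp3r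
    rw [hσ]; linarith
  have hθ0 : 0 < θ := by
    have : 2 / p.toReal < 1 := (div_lt_one hppos).2 (by linarith)
    rw [hθ]; linarith
  -- replace `a` by `|a|`
  set a' : ℝ := |a| with ha'
  have hLp' : ∀ t, 0 < t → eLpNorm (u t) p volume ≤ ENNReal.ofReal (a' * t ^ (-(σ / 2))) := by
    intro t ht
    refine (hLp t ht).trans (ENNReal.ofReal_le_ofReal ?_)
    rw [show -((1 - 3 / p.toReal) / 2) = -(σ / 2) by rw [hσ]]
    exact mul_le_mul_of_nonneg_right (le_abs_self a) (Real.rpow_nonneg ht.le _)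
  unfold eKochTataruNorm
  refine ENNReal.add_lt_top.2 ⟨?_, ?_⟩
  · -- the `L^∞` part
    refine lt_of_le_of_lt (iSup₂_le fun t ht => ?_) (ENNReal.ofReal_lt_top (r := b))
    calc ENNReal.ofReal (Real.sqrt t) * eLpNorm (u t) ⊤ volume
        ≤ ENNReal.ofReal (Real.sqrt t) * ENNReal.ofReal (b * t ^ (-(1 / 2 : ℝ))) := by
          gcongr
          rw [eLpNorm_exponent_top]
          exact eLpNormEssSup_le_of_ae_bound (Eventually.of_forall (hinf t ht))
      _ = ENNReal.ofReal b := by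
          rw [← ENNReal.ofReal_mul (Real.sqrt_nonneg _)]
          congr 1
          rw [Real.sqrt_eq_rpow, mul_left_comm, ← Real.rpow_add ht]
          norm_num
  · -- the Carleson part
    rw [hE]
    set V₁ : ℝ≥0∞ := volume (ball (0 : E) 1) with hV₁
    have hV₁top : V₁ ≠ ∞ := measure_ball_lt_top.ne
    set Cst : ℝ≥0∞ := (V₁ ^ θ * ENNReal.ofReal (a' ^ 2 / (1 - σ))) ^ (1 / 2 : ℝ) with hCst
    have hCsttop : Cst < ∞ := by
      refine ENNReal.rpow_lt_top_of_nonneg (by norm_num) (ENNReal.mul_ne_top ?_ ENNReal.ofReal_ne_top)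
      exact ENNReal.rpow_ne_top_of_nonneg hθ0.le hV₁top
    refine lt_of_le_of_lt (iSup_le fun x => iSup₂_le fun R hR => ?_) hCsttop
    -- slices
    have hslice : ∀ t, 0 < t → ∫⁻ y in ball x R, ‖u t y‖ₑ ^ 2 ≤
        (ENNReal.ofReal (R ^ 3) * V₁) ^ θ * ENNReal.ofReal (a' ^ 2 * t ^ (-σ)) := by
      intro t ht
      refine (lintegral_ball_enorm_sq_le_rpow (hmeas t ht) hp2 hp x R).trans ?_
      rw [Measure.addHaar_ball_of_pos volume x hR, hE]
      gcongr
      calc eLpNorm (u t) p volume ^ 2 ≤ ENNReal.ofReal (a' * t ^ (-(σ / 2))) ^ 2 := by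
            gcongr; exact hLp' t ht
        _ = ENNReal.ofReal (a' ^ 2 * t ^ (-σ)) := by
            rw [← ENNReal.ofReal_pow (by positivity)]
            congr 1
            rw [mul_pow, ← Real.rpow_natCast (t ^ (-(σ / 2))) 2, ← Real.rpow_mul ht.le]
            norm_num
    -- time integral
    have htime : ∫⁻ t in Ioo 0 (R ^ 2), ∫⁻ y in ball x R, ‖u t y‖ₑ ^ 2 ≤
        (ENNReal.ofReal (R ^ 3) * V₁) ^ θ * (ENNReal.ofReal (a' ^ 2) *
          ENNReal.ofReal ((R ^ 2) ^ (1 - σ) / (1 - σ))) := by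
      calc ∫⁻ t in Ioo 0 (R ^ 2), ∫⁻ y in ball x R, ‖u t y‖ₑ ^ 2
          ≤ ∫⁻ t in Ioo 0 (R ^ 2), (ENNReal.ofReal (R ^ 3) * V₁) ^ θ *
              (ENNReal.ofReal (a' ^ 2) * ENNReal.ofReal (t ^ (-σ))) :=
            setLIntegral_mono' measurableSet_Ioo fun t ht => by
              rw [← ENNReal.ofReal_mul (by positivity)]
              exact hslice t ht.1
        _ = (ENNReal.ofReal (R ^ 3) * V₁) ^ θ * (ENNReal.ofReal (a' ^ 2) *
              ∫⁻ t in Ioo 0 (R ^ 2), ENNReal.ofReal (t ^ (-σ))) := by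
            rw [lintegral_const_mul' ((ENNReal.ofReal (R ^ 3) * V₁) ^ θ) _
              (ENNReal.rpow_ne_top_of_nonneg hθ0.le (ENNReal.mul_ne_top ENNReal.ofReal_ne_top hV₁top)),
              lintegral_const_mul' (ENNReal.ofReal (a' ^ 2)) _ ENNReal.ofReal_ne_top]
        _ = _ := by rw [lintegral_Ioo_rpow_neg hσ1 (by positivity)]
    -- the algebra of the `R`-powers
    have hRpow : (R ^ 3)⁻¹ * (R ^ 3) ^ θ * (R ^ 2) ^ (1 - σ) = 1 := by
      rw [show (R ^ 3 : ℝ) = R ^ (3 : ℝ) by norm_cast, show (R ^ 2 : ℝ) = R ^ (2 : ℝ) by norm_cast,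
        ← Real.rpow_mul hR.le, ← Real.rpow_mul hR.le, ← Real.rpow_neg_one, ← Real.rpow_mul hR.le,
        ← Real.rpow_add hR, ← Real.rpow_add hR]
      have hexp : (3 : ℝ) * -1 + 3 * θ + 2 * (1 - σ) = 0 := by
        rw [hθ, hσ]; field_simp; ring
      rw [hexp, Real.rpow_zero]
    have hkey : (ENNReal.ofReal (R ^ 3))⁻¹ * ((ENNReal.ofReal (R ^ 3) * V₁) ^ θ *
        (ENNReal.ofReal (a' ^ 2) * ENNReal.ofReal ((R ^ 2) ^ (1 - σ) / (1 - σ)))) =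
        V₁ ^ θ * ENNReal.ofReal (a' ^ 2 / (1 - σ)) := by
      rw [ENNReal.mul_rpow_of_nonneg _ _ hθ0.le, ENNReal.ofReal_rpow_of_nonneg (by positivity) hθ0.le,
        ← ENNReal.ofReal_inv_of_pos (by positivity : (0 : ℝ) < R ^ 3)]
      have h1 : ENNReal.ofReal ((R ^ 3)⁻¹) * (ENNReal.ofReal ((R ^ 3) ^ θ) * V₁ ^ θ *
          (ENNReal.ofReal (a' ^ 2) * ENNReal.ofReal ((R ^ 2) ^ (1 - σ) / (1 - σ)))) =
          V₁ ^ θ * (ENNReal.ofReal ((R ^ 3)⁻¹) * ENNReal.ofReal ((R ^ 3) ^ θ) *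
            ENNReal.ofReal ((R ^ 2) ^ (1 - σ) / (1 - σ)) * ENNReal.ofReal (a' ^ 2)) := by ring
      rw [h1, ← ENNReal.ofReal_mul (by positivity), ← ENNReal.ofReal_mul (by positivity),
        ← ENNReal.ofReal_mul (by positivity)]
      congr 1
      congr 1
      calc (R ^ 3)⁻¹ * (R ^ 3) ^ θ * ((R ^ 2) ^ (1 - σ) / (1 - σ)) * a' ^ 2
          = ((R ^ 3)⁻¹ * (R ^ 3) ^ θ * (R ^ 2) ^ (1 - σ)) * (a' ^ 2 / (1 - σ)) := by ring
        _ = a' ^ 2 / (1 - σ) := by rw [hRpow, one_mul]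
    calc ((ENNReal.ofReal (R ^ 3))⁻¹ * ∫⁻ t in Ioo 0 (R ^ 2), ∫⁻ y in ball x R, ‖u t y‖ₑ ^ 2) ^ (1 / 2 : ℝ)
        ≤ ((ENNReal.ofReal (R ^ 3))⁻¹ * ((ENNReal.ofReal (R ^ 3) * V₁) ^ θ *
            (ENNReal.ofReal (a' ^ 2) * ENNReal.ofReal ((R ^ 2) ^ (1 - σ) / (1 - σ))))) ^ (1 / 2 : ℝ) := by
          gcongr
      _ = Cst := by rw [hkey]

end KatoLp

/-! ## Symmetry of the caloric pairing for data integrable against Gaussians -/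

section Symmetry

/-- **Symmetry of the caloric pairing** `∫⟪e^{tΔ}u₀, φ⟫ = ∫⟪u₀, e^{tΔ}φ⟫` for a measurable
field `u₀` integrable against centred Gaussians and a continuous compactly supported field `φ`,
`t > 0` (the Gauss–Weierstrass kernel is even; Fubini on `E × E` under the majorant
`C‖φ(x)‖ G_{2t}(y)‖u₀(y)‖`, `x ∈ supp φ`); the left pairing is integrable. Twin of the tree's
`integral_inner_heatExtension_comm` (`Lᵖ` data) and
`integral_inner_heatExtension_eq_of_hasCompactSupport` (polynomially tempered data). [folklore] -/
theorem integral_inner_heatExtension_comm_of_integrable_heatKernel {u₀ : E → E}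
    (hu₀ : AEStronglyMeasurable u₀ volume)
    (hG : ∀ a : ℝ, 0 < a → Integrable (fun y => UnboundedOperators.heatKernel a y * ‖u₀ y‖) volume)
    {φ : E → E} (hφ : Continuous φ) (hφs : HasCompactSupport φ) {t : ℝ} (ht : 0 < t) :
    Integrable (fun x => ⟪UnboundedOperators.heatExtension u₀ t x, φ x⟫) volume ∧
      ∫ x, ⟪UnboundedOperators.heatExtension u₀ t x, φ x⟫ =
        ∫ y, ⟪u₀ y, UnboundedOperators.heatExtension φ t y⟫ := by
  have hKsymm : ∀ x y : E, UnboundedOperators.heatKernel t (x - y) = UnboundedOperators.heatKernel t (y - x) :=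
    fun x y => by simp only [UnboundedOperators.heatKernel, norm_sub_rev]
  -- the joint integrand and its domination
  set H : E → E → ℝ := fun x y => UnboundedOperators.heatKernel t (x - y) * ⟪u₀ y, φ x⟫ with hHdef
  obtain ⟨ρ, hρ⟩ := hφs.isCompact.isBounded.subset_closedBall 0
  set C : ℝ := (2 : ℝ) ^ ((Module.finrank ℝ E : ℝ) / 2) * Real.exp (ρ ^ 2 / (4 * t)) with hC
  have hdom : ∀ x y, ‖H x y‖ ≤ (C * ‖φ x‖) * (UnboundedOperators.heatKernel (2 * t) y * ‖u₀ y‖) := by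
    intro x y
    by_cases hx : φ x = 0
    · simp [hHdef, hx]
    · have hxρ : ‖x‖ ≤ ρ := by
        have : x ∈ tsupport φ := subset_tsupport _ (Function.mem_support.2 hx)
        simpa using hρ this
      have hk := UnboundedOperators.heatKernel_sub_le_mul_heatKernel_two_mul ht x y
      have hK2 : 0 ≤ UnboundedOperators.heatKernel (2 * t) y :=
        (UnboundedOperators.heatKernel_pos (by positivity) y).le
      have hB : (2 : ℝ) ^ ((Module.finrank ℝ E : ℝ) / 2) * Real.exp (‖x‖ ^ 2 / (4 * t)) ≤ C := by
        rw [hC]; gcongr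
      rw [hHdef]
      simp only [norm_mul, Real.norm_eq_abs, abs_of_pos (UnboundedOperators.heatKernel_pos ht _)]
      have hinner : |⟪u₀ y, φ x⟫| ≤ ‖u₀ y‖ * ‖φ x‖ := abs_real_inner_le_norm _ _
      calc UnboundedOperators.heatKernel t (x - y) * |⟪u₀ y, φ x⟫|
          ≤ (C * UnboundedOperators.heatKernel (2 * t) y) * (‖u₀ y‖ * ‖φ x‖) :=
            mul_le_mul (hk.trans (mul_le_mul_of_nonneg_right hB hK2)) hinner (abs_nonneg _)
              (by positivity)
        _ = C * ‖φ x‖ * (UnboundedOperators.heatKernel (2 * t) y * ‖u₀ y‖) := by ring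
  have hHm : AEStronglyMeasurable (uncurry H) ((volume : Measure E).prod volume) := by
    have h1 : Continuous fun z : E × E => UnboundedOperators.heatKernel t (z.1 - z.2) :=
      (UnboundedOperators.continuous_heatKernel t).comp (continuous_fst.sub continuous_snd)
    exact h1.aestronglyMeasurable.mul (hu₀.comp_snd.inner (hφ.comp continuous_fst).aestronglyMeasurable)
  have hHint : Integrable (uncurry H) ((volume : Measure E).prod volume) := by
    have hgi : Integrable (fun x => C * ‖φ x‖) volume :=
      (hφ.integrable_of_hasCompactSupport hφs).norm.const_mul C
    refine (hgi.mul_prod (hG (2 * t) (by positivity))).mono' hHm (Eventually.of_forall fun z => ?_)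
    exact hdom z.1 z.2
  -- the inner integrals
  have hinner_x : ∀ x, ∫ y, H x y = ⟪UnboundedOperators.heatExtension u₀ t x, φ x⟫ := by
    intro x
    have hi : Integrable (fun y => UnboundedOperators.heatKernel t (x - y) • u₀ y) volume :=
      integrable_heatKernel_sub_smul hu₀ hG ht x
    rw [heatExtension_eq_integral_sub, real_inner_comm (φ x), ← integral_inner hi (φ x)]
    refine integral_congr_ae (Eventually.of_forall fun y => ?_)
    show UnboundedOperators.heatKernel t (x - y) * ⟪u₀ y, φ x⟫ =
      ⟪φ x, UnboundedOperators.heatKernel t (x - y) • u₀ y⟫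
    rw [real_inner_smul_right]
    congr 1
    exact real_inner_comm (φ x) (u₀ y)
  have hinner_y : ∀ y, ∫ x, H x y = ⟪u₀ y, UnboundedOperators.heatExtension φ t y⟫ := by
    intro y
    have hi : Integrable (fun x => UnboundedOperators.heatKernel t (y - x) • φ x) volume :=
      (((UnboundedOperators.continuous_heatKernel t).comp (continuous_const.sub continuous_id)).smul
        hφ).integrable_of_hasCompactSupport hφs.smul_left
    rw [heatExtension_eq_integral_sub, ← integral_inner hi (u₀ y)]
    refine integral_congr_ae (Eventually.of_forall fun x => ?_)
    show UnboundedOperators.heatKernel t (x - y) * ⟪u₀ y, φ x⟫ =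
      ⟪u₀ y, UnboundedOperators.heatKernel t (y - x) • φ x⟫
    rw [real_inner_smul_right, hKsymm x y]
  refine ⟨(hHint.integral_prod_left).congr (Eventually.of_forall hinner_x), ?_⟩
  calc ∫ x, ⟪UnboundedOperators.heatExtension u₀ t x, φ x⟫
      = ∫ x, ∫ y, H x y := integral_congr_ae (Eventually.of_forall fun x => (hinner_x x).symm)
    _ = ∫ y, ∫ x, H x y := integral_integral_swap hHint
    _ = ∫ y, ⟪u₀ y, UnboundedOperators.heatExtension φ t y⟫ :=
        integral_congr_ae (Eventually.of_forall fun y => hinner_y y)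

end Symmetry

/-! ## The caloric extension of a test function as a Schwartz function -/

section SchwartzBridge

/-- The complexified caloric extension of a test function: `e^{sΔ}(θ^ℂ)(x) = (e^{sΔ}θ(x) : ℂ)`
for `s > 0` (the embedding `ℝ → ℂ` commutes with the absolutely convergent convolution integral).
[folklore] -/
theorem heatExtension_ofReal_apply {θ : E → ℝ}
    (hθ : FunctionSpaces.IsTestFunctionOn (⊤ : TopologicalSpace.Opens E) θ) {s : ℝ} (hs : 0 < s)
    (x : E) :
    UnboundedOperators.heatExtension (fun y => ((θ y : ℝ) : ℂ)) s x =
      ((UnboundedOperators.heatExtension θ s x : ℝ) : ℂ) := by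
  rw [UnboundedOperators.heatExtension_apply, UnboundedOperators.heatExtension_apply]
  have hint : Integrable (fun y : E => UnboundedOperators.heatKernel s y • θ (x - y)) := by
    have h := UnboundedOperators.integrable_heatKernel_holds (E := E) hs
    obtain ⟨C, hC⟩ := (hθ.contDiff.continuous.norm).bddAbove_range_of_hasCompactSupport
      hθ.hasCompactSupport.norm
    refine (h.norm.mul_const C).mono' ?_ (Eventually.of_forall fun y => ?_)
    · exact h.aestronglyMeasurable.smul
        ((hθ.contDiff.continuous.comp (continuous_const.sub continuous_id)).aestronglyMeasurable)
    · rw [norm_smul]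
      exact mul_le_mul_of_nonneg_left (hC ⟨x - y, rfl⟩) (norm_nonneg _)
  have h := (Complex.ofRealCLM).integral_comp_comm hint
  have heq : (fun y : E => Complex.ofRealCLM (UnboundedOperators.heatKernel s y • θ (x - y))) =
      fun y => UnboundedOperators.heatKernel s y • (((θ (x - y) : ℝ)) : ℂ) := by
    funext y
    rw [map_smul, Complex.ofRealCLM_apply]
  rw [heq] at h
  rw [h, Complex.ofRealCLM_apply]

/-- **The Schwartz-space heat semigroup of a real test function is its caloric extension**:
for `θ ∈ C_c^∞(E; ℝ)` with complexification `θ^ℂ ∈ 𝓢(E, ℂ)` and `s > 0`,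
`(SchwartzMap.heatSemigroup s θ^ℂ)(x) = (heatExtension θ s x : ℂ)` — the bridge between the
multiplier semigroup `𝓕⁻¹e^{-(2π)²s|ξ|²}𝓕` on `𝓢` and the kernel semigroup (convolution theorem
`𝓕(G_s ⋆ g) = 𝓕G_s · 𝓕g`, `𝓕G_s = e^{-(2π)²s|ξ|²}`, Fourier inversion for the continuous integrable
`G_s ⋆ g`; scalar twin of `caloricSchwartz_apply` of `FujitaKatoTestFields.lean`;
Stein–Weiss 1971, Ch. I, Thm. 1.13). [folklore] -/
theorem schwartz_heatSemigroup_toSchwartzMap_apply {θ : E → ℝ}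
    (hθ : FunctionSpaces.IsTestFunctionOn (⊤ : TopologicalSpace.Opens E) θ) {s : ℝ} (hs : 0 < s)
    (x : E) :
    SchwartzMap.heatSemigroup s ((hθ.hasCompactSupport.comp_left Complex.ofReal_zero).toSchwartzMap
        (Complex.ofRealCLM.contDiff.comp hθ.contDiff)) x =
      ((UnboundedOperators.heatExtension θ s x : ℝ) : ℂ) := by
  set θS : 𝓢(E, ℂ) := (hθ.hasCompactSupport.comp_left Complex.ofReal_zero).toSchwartzMap
    (Complex.ofRealCLM.contDiff.comp hθ.contDiff) with hθS
  set g : E → ℂ := fun y => ((θ y : ℝ) : ℂ) with hg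
  have hg_eq : (θS : E → ℂ) = g := rfl
  have hg_cs : HasCompactSupport g := hθ.hasCompactSupport.comp_left Complex.ofReal_zero
  have hg_cd : ContDiff ℝ ((⊤ : ℕ∞) : WithTop ℕ∞) g := Complex.ofRealCLM.contDiff.comp hθ.contDiff
  set Kc : E → ℂ := fun y => (UnboundedOperators.heatKernel s y : ℂ) with hKc
  have hKc_int : Integrable Kc := (UnboundedOperators.integrable_heatKernel_holds (E := E) hs).ofReal
  set ψ : E → ℂ := Kc ⋆[ContinuousLinearMap.lsmul ℂ ℂ, volume] g with hψ
  have hψ_eq : ∀ y, ψ y = ((UnboundedOperators.heatExtension θ s y : ℝ) : ℂ) := fun y => by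
    rw [hψ, UnboundedOperators.convolution_ofReal_heatKernel_eq_heatExtension,
      heatExtension_ofReal_apply hθ hs]
  have hψ_cont : Continuous ψ :=
    hg_cs.continuous_convolution_right _ hKc_int.locallyIntegrable hg_cd.continuous
  have hψ_int : Integrable ψ := hKc_int.integrable_convolution _ θS.integrable
  have hFψ : 𝓕 ψ = (SchwartzMap.smulLeftCLM ℂ (fun ξ : E => (UnboundedOperators.heatSymbol s ξ : ℂ))
      (𝓕 θS) : E → ℂ) := by
    funext ζ
    have hgi : Integrable g := θS.integrable
    rw [hψ, Real.fourier_smul_convolution_eq hKc_int hgi, hKc,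
      UnboundedOperators.fourierIntegral_heatKernel_holds hs,
      SchwartzMap.smulLeftCLM_heatSymbol_apply hs.le, ← hg_eq, ← SchwartzMap.fourier_coe]
  have hFψ_int : Integrable (𝓕 ψ) := by
    rw [hFψ]
    exact SchwartzMap.integrable _
  have hinv : 𝓕⁻ (𝓕 ψ) = ψ := hψ_cont.fourierInv_fourier_eq hψ_int hFψ_int
  calc SchwartzMap.heatSemigroup s θS x
      = 𝓕⁻ (SchwartzMap.smulLeftCLM ℂ (fun ξ : E => (UnboundedOperators.heatSymbol s ξ : ℂ)) (𝓕 θS) :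
          E → ℂ) x := by
        rw [SchwartzMap.heatSemigroup_apply_eq_fourierInv_smulLeftCLM, ← SchwartzMap.fourierInv_coe]
    _ = 𝓕⁻ (𝓕 ψ) x := by rw [hFψ]
    _ = ψ x := by rw [hinv]
    _ = ((UnboundedOperators.heatExtension θ s x : ℝ) : ℂ) := hψ_eq x

end SchwartzBridge

/-! ## The free evolution of a weakly divergence-free tempered datum -/

section DivFree

variable {ι : Type*} [Fintype ι]

/-- **Integrability of `e^{sΔ}θ • u₀` for a field with a tempered distribution** and a real test
function `θ`, `s > 0`: `e^{sΔ}θ` is (the real part of) a Schwartz function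
(`schwartz_heatSemigroup_toSchwartzMap_apply`), against which `u₀` is integrable
(`IsDistributionOf`). [folklore] -/
theorem integrable_heatExtension_test_smul {u₀ : E → EuclideanSpace ℝ ι}
    {U₀ : 𝓢'(E, EuclideanSpace ℂ ι)} (hU₀ : IsDistributionOf u₀ U₀) {θ : E → ℝ}
    (hθ : FunctionSpaces.IsTestFunctionOn (⊤ : TopologicalSpace.Opens E) θ) {s : ℝ} (hs : 0 < s) :
    Integrable (fun x => UnboundedOperators.heatExtension θ s x • u₀ x) volume := by
  set θS : 𝓢(E, ℂ) := (hθ.hasCompactSupport.comp_left Complex.ofReal_zero).toSchwartzMap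
    (Complex.ofRealCLM.contDiff.comp hθ.contDiff) with hθS
  set ψ : 𝓢(E, ℂ) := SchwartzMap.heatSemigroup s θS with hψ
  have hψx : ∀ x, ψ x = ((UnboundedOperators.heatExtension θ s x : ℝ) : ℂ) := fun x =>
    schwartz_heatSemigroup_toSchwartzMap_apply hθ hs x
  have hint := (hU₀ ψ).1
  have hcont : Continuous (UnboundedOperators.heatExtension θ s) :=
    (UnboundedOperators.contDiff_heatExtension_of_hasCompactSupport hθ.contDiff hθ.hasCompactSupport s).continuous
  refine hint.norm.mono' (hcont.aestronglyMeasurable.smul hU₀.aestronglyMeasurable)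
    (Eventually.of_forall fun x => ?_)
  rw [norm_smul, norm_smul, hψx, Complex.norm_real, FunctionSpaces.EuclideanSpace.norm_complexify]

/-- **The free evolution of a weakly divergence-free field with a tempered distribution is weakly
divergence free** (Lemarié-Rieusset 2016, Cor. 6.2: `div e^{tΔ}u₀ = e^{tΔ} div u₀ = 0`;
Koch–Tataru 2001, §3): for `θ ∈ C_c^∞`, `∫⟪e^{tΔ}u₀, ∇θ⟫ = ∫⟪u₀, e^{tΔ}∇θ⟫ = ∫ D(e^{tΔ}θ)(u₀) = 0`,
the symmetry of the caloric pairing, `e^{tΔ}∇θ = ∇(e^{tΔ}θ)`, and the weak divergence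
constraint tested with the smooth Gaussian-decaying `e^{tΔ}θ`
(`IsWeaklyDivFree.integral_fderiv_apply_eq_zero`), whose integrability hypotheses hold because
`e^{tΔ}θ` and its partial derivatives are Schwartz functions. Twin of the tree's
`isWeaklyDivFree_heatExtension` (polynomially tempered data). [cite: LemarieRieusset2016, Cor. 6.2] -/
theorem isWeaklyDivFree_heatExtension_of_isDistributionOf
    {u₀ : EuclideanSpace ℝ ι → EuclideanSpace ℝ ι} {U₀ : 𝓢'(EuclideanSpace ℝ ι, EuclideanSpace ℂ ι)}
    (hU₀ : IsDistributionOf u₀ U₀) (hdiv : IsWeaklyDivFree u₀) {t : ℝ} (ht : 0 < t) :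
    IsWeaklyDivFree (UnboundedOperators.heatExtension u₀ t) := by
  haveI : CompleteSpace (EuclideanSpace ℝ ι) := FiniteDimensional.complete ℝ _
  have hmeas : AEStronglyMeasurable u₀ volume := hU₀.aestronglyMeasurable
  have hG : ∀ a : ℝ, 0 < a → Integrable (fun y => UnboundedOperators.heatKernel a y * ‖u₀ y‖) volume :=
    fun a ha => by
      have h := (hU₀ (FunctionSpaces.heatKernelSchwartz (EuclideanSpace ℝ ι) a)).1.norm
      refine h.congr (Eventually.of_forall fun y => ?_)
      simp only [norm_smul, FunctionSpaces.heatKernelSchwartz_apply ha, Complex.norm_real,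
        Real.norm_eq_abs, FunctionSpaces.EuclideanSpace.norm_complexify,
        abs_of_pos (UnboundedOperators.heatKernel_pos ha y)]
  intro θ hθ
  have hθ1 : ContDiff ℝ 1 θ := hθ.contDiff.of_le (by exact_mod_cast le_top)
  have hgc : Continuous (gradient θ) := continuous_gradient_of_contDiff hθ1
  have hgs : HasCompactSupport (gradient θ) :=
    (hθ.hasCompactSupport.fderiv (𝕜 := ℝ)).comp_left (g := (InnerProductSpace.toDual ℝ (EuclideanSpace ℝ ι)).symm)
      (map_zero _)
  rw [(integral_inner_heatExtension_comm_of_integrable_heatKernel hmeas hG hgc hgs ht).2]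
  -- `⟪u₀, e^{tΔ}∇θ⟫ = D(e^{tΔ}θ)(u₀)`
  set Θ : EuclideanSpace ℝ ι → ℝ := UnboundedOperators.heatExtension θ t with hΘdef
  have hΘ : ContDiff ℝ ((⊤ : ℕ∞) : WithTop ℕ∞) Θ :=
    UnboundedOperators.contDiff_heatExtension_of_hasCompactSupport hθ.contDiff hθ.hasCompactSupport t
  have hpt : ∀ x, ⟪u₀ x, UnboundedOperators.heatExtension (gradient θ) t x⟫ = fderiv ℝ Θ x (u₀ x) := fun x => by
    rw [heatExtension_gradient hθ t x, inner_gradient_eq_fderiv_apply]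
  simp_rw [hpt]
  -- integrability of `Θ • u₀`
  have h2 : Integrable (fun x => Θ x • u₀ x) := integrable_heatExtension_test_smul hU₀ hθ ht
  -- integrability of `DΘ(u₀)` through the coordinate expansion `DΘ(x)v = ∑ᵢ ⟪bᵢ, v⟫ ∂ᵢΘ(x)`
  set b := stdOrthonormalBasis ℝ (EuclideanSpace ℝ ι) with hb
  set θi : Fin (Module.finrank ℝ (EuclideanSpace ℝ ι)) → EuclideanSpace ℝ ι → ℝ :=
    fun i y => fderiv ℝ θ y (b i) with hθi
  have hθi_test : ∀ i, FunctionSpaces.IsTestFunctionOn (⊤ : TopologicalSpace.Opens (EuclideanSpace ℝ ι)) (θi i) := by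
    intro i
    refine ⟨?_, hθ.hasCompactSupport.fderiv_apply (𝕜 := ℝ) (b i), fun _ _ => trivial⟩
    exact (hθ.contDiff.fderiv_right le_rfl).clm_apply contDiff_const
  have hΘi : ∀ i x, fderiv ℝ Θ x (b i) = UnboundedOperators.heatExtension (θi i) t x := fun i x =>
    UnboundedOperators.fderiv_heatExtension_apply_of_hasCompactSupport hθ1 hθ.hasCompactSupport t x (b i)
  have hexp : ∀ x, fderiv ℝ Θ x (u₀ x) = ∑ i, ⟪b i, u₀ x⟫ * UnboundedOperators.heatExtension (θi i) t x := by
    intro x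
    conv_lhs => rw [← b.sum_repr' (u₀ x)]
    rw [map_sum]
    refine Finset.sum_congr rfl fun i _ => ?_
    rw [map_smul, smul_eq_mul, hΘi i x]
  have h1 : Integrable (fun x => fderiv ℝ Θ x (u₀ x)) := by
    have hterm : ∀ i, Integrable (fun x => ⟪b i, u₀ x⟫ * UnboundedOperators.heatExtension (θi i) t x) := by
      intro i
      have hI := integrable_heatExtension_test_smul hU₀ (hθi_test i) ht
      have hcont : Continuous (UnboundedOperators.heatExtension (θi i) t) :=
        (UnboundedOperators.contDiff_heatExtension_of_hasCompactSupport (hθi_test i).contDiff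
          (hθi_test i).hasCompactSupport t).continuous
      refine hI.norm.mono' ((aestronglyMeasurable_const.inner hmeas).mul hcont.aestronglyMeasurable)
        (Eventually.of_forall fun x => ?_)
      rw [norm_mul, norm_smul, Real.norm_eq_abs, Real.norm_eq_abs]
      calc |⟪b i, u₀ x⟫| * |UnboundedOperators.heatExtension (θi i) t x|
          ≤ (‖b i‖ * ‖u₀ x‖) * |UnboundedOperators.heatExtension (θi i) t x| := by
            gcongr; exact abs_real_inner_le_norm _ _
        _ = |UnboundedOperators.heatExtension (θi i) t x| * ‖u₀ x‖ := by
            rw [b.orthonormal.1 i, one_mul, mul_comm]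
    exact (integrable_finsetSum _ fun i _ => hterm i).congr (Eventually.of_forall fun x =>
      (hexp x).symm)
  exact hdiv.integral_fderiv_apply_eq_zero hmeas hΘ h1 h2

end DivFree

/-! ## (F4): Kato-class fixed points are mild solutions in the duality form -/

section Mild

/-- **(F4) A Kato-class fixed point with a tempered datum is a mild solution in the duality form**
(Lemarié-Rieusset 2016, Thm. 6.1 (PDF p. 135), (6.12) ⇒ (6.11): a solution of Oseen's integral
equation is a very weak solution; Koch–Tataru 2001, §3 (11)). Let `u₀ : ℝ³ → ℝ³` be weakly
divergence free with a tempered distribution `U₀`, `3 < p < ∞`, and let `u` be measurable on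
`(0,∞) × ℝ³` with measurable slices, `u 0 = u₀`, in Kato's class `‖u(t)‖_{L^p} ≤ a t^{-(1-3/p)/2}`,
`|u(t)(x)| ≤ b t^{-1/2}` for all `t > 0`, with `e^{tΔ}u₀ ∈ L^p` and
`u(t) = e^{tΔ}u₀ - B(u,u)(t)` a.e. for `t ∈ (0,T)` (`B = kochTataruBilinear`). Then `u` is an
unforced mild solution on `[0,T)` from `u₀` with viscosity `1`,
`IsMildNSSolutionOn (Ico 0 T) 1 0 u₀ u`: Kato's class lies in Koch–Tataru's path space
(`KatoLp.eKochTataruNorm_lt_top_of_kato_bounds`), so the tested Duhamel identity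
`∫⟪B(u,u)(t), φ⟫ = -∫₀ᵗ∫⟪u, (u·∇)e^{(t-τ)Δ}φ⟫` and the weak solenoidality of `B(u,u)(t)` of
`KochTataruPairing.lean` apply; the datum term is the symmetry
`∫⟪e^{tΔ}u₀, φ⟫ = ∫⟪u₀, e^{tΔ}φ⟫` (`integral_inner_heatExtension_comm_of_integrable_heatKernel`),
and `e^{tΔ}u₀` is weakly divergence free (`isWeaklyDivFree_heatExtension_of_isDistributionOf`).
The tree's `KatoL3.isMildNSSolutionOn_of_fixedPoint` is the case of an `L³` datum.
[cite: LemarieRieusset2016, Thm. 6.1 ((6.12) ⇒ (6.11), PDF p. 135)] -/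
theorem isMildNSSolutionOn_of_kato_fixedPoint'
    {u₀ : EuclideanSpace ℝ (Fin 3) → EuclideanSpace ℝ (Fin 3)}
    {U₀ : 𝓢'(EuclideanSpace ℝ (Fin 3), EuclideanSpace ℂ (Fin 3))}
    (hU₀ : IsDistributionOf u₀ U₀) (hdiv : IsWeaklyDivFree u₀) {p : ℝ≥0∞} [hp1 : Fact (1 ≤ p)]
    (hp₃ : 3 < p) (hp : p < ∞) {u : ℝ → EuclideanSpace ℝ (Fin 3) → EuclideanSpace ℝ (Fin 3)}
    {T a b : ℝ} (hu0 : u 0 = u₀)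
    (hmeas : AEStronglyMeasurable (uncurry u)
      ((volume : Measure (ℝ × EuclideanSpace ℝ (Fin 3))).restrict (Ioi 0 ×ˢ univ)))
    (hslice : ∀ t : ℝ, 0 < t → AEStronglyMeasurable (u t) volume)
    (hLp : ∀ t : ℝ, 0 < t → eLpNorm (u t) p volume ≤
      ENNReal.ofReal (a * t ^ (-((1 - 3 / p.toReal) / 2))))
    (hinf : ∀ t : ℝ, 0 < t → ∀ x, ‖u t x‖ ≤ b * t ^ (-(1 / 2 : ℝ)))
    (hfree : ∀ t ∈ Ioo 0 T, MemLp (UnboundedOperators.heatExtension u₀ t) p volume)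
    (hfix : ∀ t ∈ Ioo 0 T, u t =ᵐ[volume] fun x =>
      UnboundedOperators.heatExtension u₀ t x - kochTataruBilinear u u t x) :
    IsMildNSSolutionOn (Ico 0 T) 1 0 u₀ u := by
  haveI : CompleteSpace (EuclideanSpace ℝ (Fin 3)) := FiniteDimensional.complete ℝ _
  haveI hHC : p.HolderConjugate (ENNReal.conjExponent p) := .conjExponent hp1.out
  have hE3 : Module.finrank ℝ (EuclideanSpace ℝ (Fin 3)) = 3 := finrank_euclideanSpace_fin
  have hu₀m : AEStronglyMeasurable u₀ volume := hU₀.aestronglyMeasurable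
  have hG : ∀ c : ℝ, 0 < c → Integrable (fun y => UnboundedOperators.heatKernel c y * ‖u₀ y‖) volume :=
    fun c hc => by
      have h := (hU₀ (FunctionSpaces.heatKernelSchwartz (EuclideanSpace ℝ (Fin 3)) c)).1.norm
      refine h.congr (Eventually.of_forall fun y => ?_)
      simp only [norm_smul, FunctionSpaces.heatKernelSchwartz_apply hc, Complex.norm_real,
        Real.norm_eq_abs, FunctionSpaces.EuclideanSpace.norm_complexify,
        abs_of_pos (UnboundedOperators.heatKernel_pos hc y)]
  -- Kato's class lies in `X`
  have hX : eKochTataruNorm u < ∞ :=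
    KatoLp.eKochTataruNorm_lt_top_of_kato_bounds hE3 hslice hp₃ hp hinf hLp
  -- `L^p` slices on `(0, T)`
  have hup : ∀ t ∈ Ioo 0 T, MemLp (u t) p volume := fun t ht =>
    ⟨hslice t ht.1, (hLp t ht.1).trans_lt ENNReal.ofReal_lt_top⟩
  have hB : ∀ {t : ℝ}, t ∈ Ioo 0 T → MemLp (kochTataruBilinear u u t) p volume := by
    intro t ht
    have hae : kochTataruBilinear u u t =ᵐ[volume]
        fun x => UnboundedOperators.heatExtension u₀ t x - u t x := by
      filter_upwards [hfix t ht] with x hx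
      rw [hx]
      abel
    exact ((hfree t ht).sub (hup t ht)).ae_eq hae.symm
  refine ⟨fun t ht => ?_, fun t ht => ?_⟩
  · -- weak divergence-freeness of the slices
    rcases ht.1.eq_or_lt with h | hpos
    · rw [← h, hu0]
      exact hdiv
    · have htT : t ∈ Ioo 0 T := ⟨hpos, ht.2⟩
      have hUdiv := isWeaklyDivFree_heatExtension_of_isDistributionOf hU₀ hdiv hpos
      have hBdiv := isWeaklyDivFree_kochTataruBilinear hmeas hmeas hX hX t
      exact (hUdiv.sub hp1.out hBdiv (hfree t htT) (hB htT)).congr_ae (hfix t htT).symm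
  · -- the duality identity from the datum
    rcases ht.1.eq_or_lt with h | hpos
    · rw [← h]
      refine isMildNSSolutionFrom_zero_iff.2 fun φ _ _ => ?_
      rw [hu0]
    · have htT : t ∈ Ioo 0 T := ⟨hpos, ht.2⟩
      intro φ hφ hφdiv
      simp only [Pi.zero_apply, inner_zero_left, integral_zero, intervalIntegral.integral_zero,
        add_zero]
      have hsym := integral_inner_heatExtension_comm_of_integrable_heatKernel hu₀m hG
        hφ.contDiff.continuous hφ.hasCompactSupport hpos
      -- split `u(t) = e^{tΔ}u₀ - B(t)` inside the pairing
      have iU : Integrable (fun x => ⟪UnboundedOperators.heatExtension u₀ t x, φ x⟫) volume := hsym.1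
      have iB : Integrable (fun x => ⟪kochTataruBilinear u u t x, φ x⟫) volume :=
        integrable_inner_kochTataruBilinear hmeas hmeas hX hX hpos hφ.contDiff.continuous
          hφ.hasCompactSupport
      have hsplit : ∫ x, ⟪u t x, φ x⟫ = (∫ x, ⟪UnboundedOperators.heatExtension u₀ t x, φ x⟫) -
          ∫ x, ⟪kochTataruBilinear u u t x, φ x⟫ := by
        rw [← integral_sub iU iB]
        refine integral_congr_ae ?_
        filter_upwards [hfix t htT] with x hx
        rw [hx, inner_sub_left]
      have hdat : ∫ x, ⟪UnboundedOperators.heatExtension u₀ t x, φ x⟫ =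
          ∫ x, ⟪u₀ x, heatTest 1 φ t x⟫ := by
        rw [heatTest_of_pos one_pos hpos, one_mul]
        exact hsym.2
      have hnl := integral_inner_kochTataruBilinear_eq_neg_intervalIntegral hmeas hX hpos hφ hφdiv
      rw [hsplit, hdat, hnl]
      ring

end Mild

end Literature.Analysis.FluidPDE
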